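import Literature.AlgebraicTopology.SingularHomology.ExternalCollarHomology
import Literature.AlgebraicTopology.SingularHomology.CechCapBridge
import Literature.AlgebraicTopology.SingularHomology.CohomologyHomotopyInvariance
import HarnessLib

/-!
# Lefschetz duality for `(W, ∂W)` from Čech duality for `W` in its external collar

H. Miller, *Lectures on Algebraic Topology* (2020), Thm. 37.1 / Cor. 37.4: for a compact `K` in an
`R`-oriented `n`-manifold `M`, `- ⌢ [M]_K : Ȟ^p(K; R) → H_q(M, M − K; R)` is an isomorphism, where
`Ȟ^p(K) = lim_→ H^p(U)` over the open `U ⊇ K` (Def. 34.4) "may be computed along any cofinal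
family of neighbourhoods"; and A. Hatcher, *Algebraic Topology* (2002), §3.3, Thm. 3.43 (Lefschetz
duality, `Hᵏ(M; R) ≅ Hₙ₋ₖ(M, ∂M; R)` by cap product with the relative fundamental class) with the
proof of Prop. 3.42 (the external collar) and p. 254 (deformation retractions along collars).

For a compact Hausdorff `W` charted on the half-space, `X = ExtCollar n W` its external collar
(`…ExternalCollar`: a boundaryless `(n+1)`-manifold) and `K = incl W` (compact), this file PROVES
that Čech duality for `(X, K)` — the property `CechDuality` of `…CechDualityContinuity`, i.e. the
conclusion of Miller's Thm. 37.1 — with the class `μ = toExtCollar z ∈ Hₘ(X | K)` of a relative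
class `z ∈ Hₘ(W, ∂W; R)` (`…ExternalCollarHomology`) implies that
`a ↦ a ⌢ z : Hᵖ(W; R) → H_q(W, ∂W; R)` is bijective for all `p + q = m`
(`ExtCollar.bijective_relCapProduct_of_cechDuality`). With `z` a relative fundamental class (for
which `μ` is an orientation along `K`, `isGenerator_restrictToPoint_toExtCollar`) this is Lefschetz
duality `bijective_relCapProduct_of_isRelFundamentalClass` (`…LefschetzDuality`, Spanier Thm. 6.3.12)
— WITHOUT any collar theorem. Ingredients, all proved:

* `ExtCollar.isIso_resH_univ_collarNhd` — `H^p_X(X) → H^p_X(W ∪ ∂W × (-ε, 0])` is an isomorphism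
  (the collar neighbourhood is a deformation retract: dual of a quasi-isomorphism of free chain
  complexes, `isIso_homologyMap_dualMap_of_quasiIso`);
* `ExtCollar.of_univ_bijective` — **`H^p_X(X) → Ȟ^p(K)` is bijective**: the collar neighbourhoods
  are cofinal (`exists_collarNhd_subset`, `W` compact), so `W` is "taut" in `X` for free;
* `ExtCollar.isIso_cohomologyMap_incl` — `incl^* : Hᵖ(X) ≅ Hᵖ(W)` (inverse `base^*`, homotopy
  invariance of singular cohomology);
* the projection formula for the maps of pairs `𝟙 : (X, X ∖ K) → (X, C)` and
  `incl : (W, ∂W) → (X, C)` (`map_relCapProduct`, `…CechCapBridge`), giving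
  `a ⌢ z = Φ⁻¹ (base^* a ⌢ Φ z)` for `Φ = toExtCollar`, and the bridge `cechCap_of_univ_thetaInv`
  identifying `base^* a ⌢ Φ z` with the Čech cap product — so that `a ↦ a ⌢ z` is a composite of
  `base^*`, `Θ⁻¹`, `Cech.of univ`, `cechCap … μ` and model isomorphisms, all bijective.

Everything is proved; no named facts.

## References

* H. Miller, *Lectures on Algebraic Topology*, World Scientific 2020, Def. 34.4, Thm. 37.1,
  Cor. 37.4. [Miller2020]
* A. Hatcher, *Algebraic Topology*, CUP 2002, §3.3 Thm. 3.43, proof of Prop. 3.42, p. 254; §3.1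
  p. 201. [HatcherAT2002]
* E. H. Spanier, *Algebraic Topology*, Springer 1981, Ch. 6 §3 Thm. 12. [Spanier1981]
-/

noncomputable section

open CategoryTheory Limits Set Topology unitInterval
open scoped Manifold Topology

universe u v

namespace Literature.AlgebraicTopology.SingularHomology

namespace ExtCollar

variable (R : Type v) [CommRing R]
variable {n : ℕ} {W : Type u} [TopologicalSpace W] [ChartedSpace (EuclideanHalfSpace (n + 1)) W]

/-! ### The collar neighbourhoods are deformation retracts: `H^p_X(X) ≅ H^p_X(collarNhd ε)` -/

section CollarNhd

variable {ε : ℝ} (hε : 0 < ε)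
include hε

/-- The retraction `X → collarNhd ε`, `x ↦ incl (base x)` (into `W ⊆ collarNhd ε`), as a map of
subtypes `↥univ → ↥(collarNhd ε)`. [folklore] -/
def retractCM : C(↥(Set.univ : Set (ExtCollar n W)), ↥(collarNhd ε : Set (ExtCollar n W))) where
  toFun x := ⟨incl n (base x.1), range_incl_subset_collarNhd hε ⟨_, rfl⟩⟩
  continuous_toFun := (continuous_incl.comp (continuous_base.comp continuous_subtype_val)).subtype_mk _

/-- The inclusion `collarNhd ε ↪ X` as a map of subtypes. [folklore] -/
abbrev inclNhdCM : C(↥(collarNhd ε : Set (ExtCollar n W)), ↥(Set.univ : Set (ExtCollar n W))) :=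
  ⟨Set.inclusion (Set.subset_univ _), continuous_inclusion _⟩

omit hε in
/-- `inclusion ∘ retract ≃ 𝟙` on `X` (the squeeze). [folklore] -/
def homotopyInclRetract :
    ContinuousMap.Homotopy ((inclNhdCM (n := n) (W := W) (ε := ε)).comp (retractCM hε))
      (ContinuousMap.id _) where
  toFun tx := ⟨squeeze (tx.1 : ℝ) tx.2.1, Set.mem_univ _⟩
  continuous_toFun := (continuous_squeeze.comp
    ((continuous_subtype_val.comp continuous_fst).prodMk (continuous_subtype_val.comp continuous_snd))).subtype_mk _
  map_zero_left x := Subtype.ext (squeeze_zero x.1)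
  map_one_left x := Subtype.ext (squeeze_one x.1)

/-- `retract ∘ inclusion ≃ 𝟙` on `collarNhd ε` (the squeeze preserves the collar neighbourhood). [folklore] -/
def homotopyRetractIncl :
    ContinuousMap.Homotopy ((retractCM hε).comp (inclNhdCM (n := n) (W := W) (ε := ε)))
      (ContinuousMap.id _) where
  toFun tx := ⟨squeeze (tx.1 : ℝ) tx.2.1, squeeze_mem_collarNhd (unitInterval.le_one tx.1) tx.2.2⟩
  continuous_toFun := (continuous_squeeze.comp
    ((continuous_subtype_val.comp continuous_fst).prodMk (continuous_subtype_val.comp continuous_snd))).subtype_mk _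
  map_zero_left x := Subtype.ext (squeeze_zero x.1)
  map_one_left x := Subtype.ext (squeeze_one x.1)

/-- The inclusion `collarNhd ε ↪ X` induces isomorphisms on singular homology. [folklore] -/
theorem isIso_singularHomology_map_inclNhd (M : Type v) [AddCommGroup M] [Module R M] (k : ℕ) :
    IsIso (singularHomology.map R M (inclNhdCM (n := n) (W := W) (ε := ε)) k) := by
  refine ⟨⟨singularHomology.map R M (retractCM hε) k, ?_, ?_⟩⟩
  · rw [← singularHomology.map_comp, singularHomology.map_eq_of_homotopic R M ⟨homotopyRetractIncl hε⟩,
      singularHomology.map_id]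
  · rw [← singularHomology.map_comp, singularHomology.map_eq_of_homotopic R M ⟨homotopyInclRetract hε⟩,
      singularHomology.map_id]

/-- The same in the concrete model of the subcomplexes `C_X(collarNhd ε) ↪ C_X(univ)`: the inclusion
is a quasi-isomorphism. [folklore] -/
theorem quasiIso_incl_collarNhd :
    QuasiIso (Subcomplex.incl (chainsInSub_mono R R
      (Set.subset_univ (collarNhd ε : Set (ExtCollar n W))))) :=
  ⟨fun k => by
    rw [quasiIsoAt_iff_isIso_homologyMap]
    refine clocalHomology.isIso_homologyMap_incl_of_isIso R R
      (Set.subset_univ (collarNhd ε : Set (ExtCollar n W))) k ?_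
    rw [csingularHomology.map_eq_conj]
    haveI := isIso_singularHomology_map_inclNhd (n := n) (W := W) R hε R k
    infer_instance⟩

/-- **`H^p_X(X; N) → H^p_X(collarNhd ε; N)` is an isomorphism** (dual of the quasi-isomorphism
of free chain complexes `C_X(collarNhd ε) ↪ C_X(X)`; Hatcher 2002, §3.1 p. 201, homotopy
invariance of cohomology). [cite: HatcherAT2002, §3.1 p. 201] -/
theorem isIso_resH_univ_collarNhd (N : ModuleCat.{max u v} R) (p : ℕ) :
    IsIso (subsetCochains.resH (N := N) (Set.subset_univ (collarNhd ε : Set (ExtCollar n W))) p) :=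
  haveI := quasiIso_incl_collarNhd (n := n) (W := W) R hε
  isIso_homologyMap_dualMap_of_quasiIso _ p

end CollarNhd

/-! ### `H^p_X(X) → Ȟ^p(K)` is bijective for `K = W` compact -/

section Cech

variable (N : ModuleCat.{max u v} R)

/-- The collar neighbourhood `collarNhd ε` as an open neighbourhood of `K = incl W`. [folklore] -/
def collarOpenNhd {ε : ℝ} (hε : 0 < ε) : OpenNhd (ExtCollar n W) (range (incl n)) :=
  ⟨collarNhd ε, isOpen_collarNhd ε, range_incl_subset_collarNhd hε⟩

/-- Restrictions in the directed system compose (for rewriting on elements). [folklore] -/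
lemma resH_resH_apply {A B C : Set (ExtCollar n W)} (h : A ⊆ B) (h' : B ⊆ C) (p : ℕ)
    (a : (subsetCochains R N C).homology p) :
    subsetCochains.resH (N := N) h p (subsetCochains.resH (N := N) h' p a) =
      subsetCochains.resH (N := N) (h.trans h') p a := by
  rw [← ModuleCat.comp_apply]
  change (HomologicalComplex.homologyMap (subsetCochains.res R N h') p ≫
    HomologicalComplex.homologyMap (subsetCochains.res R N h) p) a = _
  rw [← HomologicalComplex.homologyMap_comp, ← subsetCochains.res_comp]

variable [T2Space W] [CompactSpace W]

/-- **`H^p_X(X; N) → Ȟ^p(K; N)` is bijective for `K = incl W`, `W` compact**: the collar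
neighbourhoods are cofinal among the open neighbourhoods of `K` (`exists_collarNhd_subset`) and
`H^p_X(X) → H^p_X(collarNhd ε)` are isomorphisms — `Ȟ^p(K)` "may be computed along any cofinal
family" (Miller 2020, Def. 34.4 / Lemma 35.6). [cite: Miller2020, Def. 34.4] -/
theorem of_univ_bijective (p : ℕ) :
    Function.Bijective (Cech.of R N (K := range (incl n : W → ExtCollar n W)) (p := p)
      (OpenNhd.univ (range (incl n)))) := by
  constructor
  · intro a b hab
    obtain ⟨U, hU, e⟩ := (Cech.of_eq_of_iff a b).1 hab
    obtain ⟨ε, hε, hεU⟩ := exists_collarNhd_subset U.isOpen U.subset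
    have hV : (collarOpenNhd (n := n) (W := W) hε).carrier ⊆ U.carrier := hεU
    have key : ∀ c : (subsetCochains R N (OpenNhd.univ (range (incl n : W → ExtCollar n W))).carrier).homology p,
        subsetCochains.resH (N := N) hV p (subsetCochains.resH (N := N) hU p c) =
          subsetCochains.resH (N := N) (Set.subset_univ (collarNhd ε : Set (ExtCollar n W))) p c :=
      fun c => resH_resH_apply R N hV hU p c
    haveI := isIso_resH_univ_collarNhd (n := n) (W := W) R hε N p
    apply (ModuleCat.mono_iff_injective
      (subsetCochains.resH (N := N) (Set.subset_univ (collarNhd ε : Set (ExtCollar n W))) p)).mp inferInstance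
    rw [← key a, ← key b]
    exact congrArg _ e
  · intro z
    obtain ⟨U, a, rfl⟩ := Cech.exists_of z
    obtain ⟨ε, hε, hεU⟩ := exists_collarNhd_subset U.isOpen U.subset
    have hV : (collarOpenNhd (n := n) (W := W) hε).carrier ⊆ U.carrier := hεU
    haveI := isIso_resH_univ_collarNhd (n := n) (W := W) R hε N p
    obtain ⟨b, hb⟩ := (ModuleCat.epi_iff_surjective
      (subsetCochains.resH (N := N) (Set.subset_univ (collarNhd ε : Set (ExtCollar n W))) p)).mp inferInstance
      (subsetCochains.resH (N := N) hV p a)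
    refine ⟨b, ?_⟩
    have h1 := Cech.of_res (R := R) (N := N) (U := OpenNhd.univ (range (incl n)))
      (V := collarOpenNhd (n := n) (W := W) hε) (Set.subset_univ _) b
    have h2 := Cech.of_res (R := R) (N := N) (U := U) (V := collarOpenNhd (n := n) (W := W) hε) hV a
    rw [← h1, ← h2]
    exact congrArg _ hb

end Cech

/-! ### `incl^* : Hᵖ(X) ≅ Hᵖ(W)` -/

section Cohomology

variable (M : Type v) [AddCommGroup M] [Module R M]

/-- `base^* ≫ incl^* = 𝟙` on `Hᵖ(W)` (`base ∘ incl = 𝟙`). [folklore] -/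
theorem cohomologyMap_base_comp_incl (p : ℕ) :
    singularCohomology.map R M (baseCM (n := n) (W := W)) p ≫ singularCohomology.map R M (inclCM n) p = 𝟙 _ := by
  rw [← singularCohomology.map_comp, baseCM_comp_inclCM, singularCohomology.map_id]

/-- `incl^* ≫ base^* = 𝟙` on `Hᵖ(X)` (`incl ∘ base ≃ 𝟙`, homotopy invariance of cohomology).
[cite: HatcherAT2002, §3.1 p. 201] -/
theorem cohomologyMap_incl_comp_base (p : ℕ) :
    singularCohomology.map R M (inclCM n) p ≫ singularCohomology.map R M (baseCM (n := n) (W := W)) p = 𝟙 _ := by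
  rw [← singularCohomology.map_comp,
    singularCohomology.map_eq_of_homotopic_holds R M ⟨squeezeHomotopy⟩ p, singularCohomology.map_id]

/-- **`incl^* : Hᵖ(X; M) → Hᵖ(W; M)` is an isomorphism** (the external collar deformation retracts
onto `W`). [cite: HatcherAT2002, §3.1 p. 201] -/
instance isIso_cohomologyMap_incl (p : ℕ) : IsIso (singularCohomology.map R M (inclCM n (W := W)) p) :=
  ⟨⟨singularCohomology.map R M baseCM p, cohomologyMap_incl_comp_base R M p, cohomologyMap_base_comp_incl R M p⟩⟩

/-- `base^* : Hᵖ(W; M) → Hᵖ(X; M)` is an isomorphism. [folklore] -/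
instance isIso_cohomologyMap_base (p : ℕ) : IsIso (singularCohomology.map R M (baseCM (n := n) (W := W)) p) :=
  ⟨⟨singularCohomology.map R M (inclCM n) p, cohomologyMap_base_comp_incl R M p, cohomologyMap_incl_comp_base R M p⟩⟩

/-- `incl^* (base^* a) = a`. [folklore] -/
@[simp] lemma cohomologyMap_incl_base (p : ℕ) (a : singularCohomology R M W p) :
    singularCohomology.map R M (inclCM n) p (singularCohomology.map R M baseCM p a) = a := by
  rw [← ModuleCat.comp_apply, cohomologyMap_base_comp_incl]
  rfl

end Cohomology

/-! ### Lefschetz duality from Čech duality -/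

section Duality

variable {R}

/-- Local notation: the coefficient object `R` of `ModuleCat.{max u v} R`. -/
local notation "𝑹" => SimplexSpan.coefR R

/-- `incl⁎ ∘ Φ⁻¹ = ι₁`: the inverse of `toExtCollar` followed by `incl⁎ : H(W, ∂W) → H(X, C)` is
`H(X, X ∖ K) → H(X, C)`. [folklore] -/
lemma map_incl_toExtCollar_inv (q : ℕ) (y : localHomologyOfSet R R (ExtCollar n W) (range (incl n)) q) :
    relativeSingularHomology.map R R (inclCM n) mapsTo_incl_closedCollar q ((toExtCollar R R q).inv y) =
      relativeSingularHomology.map R R (ContinuousMap.id (ExtCollar n W)) mapsTo_id_compl_closedCollar q y := by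
  simp only [toExtCollar, Iso.trans_inv, Iso.symm_inv, asIso_hom, asIso_inv, ModuleCat.comp_apply]
  rw [← ModuleCat.comp_apply, IsIso.inv_hom_id]
  rfl

/-- **`a ⌢ z = Φ⁻¹ (base^* a ⌢ Φ z)`**: the relative cap product of `(W, ∂W)` transported to the
external collar, `Φ = toExtCollar` (two applications of the projection formula, for
`𝟙 : (X, X ∖ K) → (X, C)` and `incl : (W, ∂W) → (X, C)`; Hatcher 2002, p. 241 and p. 254).
[cite: HatcherAT2002, §3.3 p. 241] -/
theorem relCapProduct_eq_toExtCollar_inv {m p q : ℕ} (h : p + q = m) (a : singularCohomology R R W p)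
    (z : relativeSingularHomology R R W ((𝓡∂ (n + 1)).boundary W) m) :
    relCapProduct (M := R) ((𝓡∂ (n + 1)).boundary W) h a z =
      (toExtCollar R R q).inv (relCapProduct (M := R) (range (incl n))ᶜ h
        (singularCohomology.map R R baseCM p a) ((toExtCollar R R m).hom z)) := by
  apply (ModuleCat.mono_iff_injective
    (relativeSingularHomology.map R R (inclCM n) (mapsTo_incl_closedCollar (W := W)) q)).mp inferInstance
  rw [map_incl_toExtCollar_inv]
  -- projection formula for `𝟙 : (X, X ∖ K) → (X, C)`
  have h1 := relativeSingularHomology.map_relCapProduct (M := R) (ContinuousMap.id (ExtCollar n W))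
    (mapsTo_id_compl_closedCollar (n := n) (W := W)) h (singularCohomology.map R R baseCM p a)
    ((toExtCollar R R m).hom z)
  rw [singularCohomology.map_id] at h1
  change relativeSingularHomology.map R R (ContinuousMap.id (ExtCollar n W)) mapsTo_id_compl_closedCollar q
      (relCapProduct (M := R) (range (incl n))ᶜ h (singularCohomology.map R R baseCM p a) ((toExtCollar R R m).hom z)) =
    relCapProduct (M := R) closedCollar h (singularCohomology.map R R baseCM p a)
      (relativeSingularHomology.map R R (ContinuousMap.id (ExtCollar n W)) mapsTo_id_compl_closedCollar m
        ((toExtCollar R R m).hom z)) at h1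
  rw [h1, map_id_toExtCollar]
  -- projection formula for `incl : (W, ∂W) → (X, C)`
  rw [← relativeSingularHomology.map_relCapProduct (M := R) (inclCM n) mapsTo_incl_closedCollar h,
    cohomologyMap_incl_base]

variable [T2Space W] [CompactSpace W]

/-- **Lefschetz duality from Čech duality.**  Let `W` be compact Hausdorff, charted on the half
space, `X = ExtCollar n W`, `K = incl W`, `z ∈ Hₘ(W, ∂W; R)` and `μ = toExtCollar z ∈ Hₘ(X | K; R)`
(read in the concrete model). If `- ⌢ μ : Ȟ^p(K; 𝑹) → H_q(X | K; R)` is bijective for all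
`p + q = m` (`CechDuality`, the conclusion of Miller 2020, Thm. 37.1 / Cor. 37.4 for `(K, μ)`), then
`a ↦ a ⌢ z : Hᵖ(W; R) → H_q(W, ∂W; R)` is bijective for all `p + q = m` — for `z` a relative
fundamental class this is Spanier's Thm. 6.3.12 / Hatcher's Thm. 3.43 (`A = ∅`).
[cite: Miller2020, Cor. 37.4; HatcherAT2002, §3.3 Thm. 3.43] -/
theorem bijective_relCapProduct_of_cechDuality {m : ℕ}
    (z : relativeSingularHomology R R W ((𝓡∂ (n + 1)).boundary W) m)
    (hC : CechDuality (R := R) (isClosed_range_incl (n := n) (W := W)) m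
      ((relativeSingularHomology.concreteIso R R (ExtCollar n W) (range (incl n))ᶜ m).hom
        ((toExtCollar R R m).hom z)))
    {p q : ℕ} (h : p + q = m) :
    Function.Bijective fun a : singularCohomology R R W p =>
      relCapProduct (M := R) ((𝓡∂ (n + 1)).boundary W) h a z := by
  set μ := (relativeSingularHomology.concreteIso R R (ExtCollar n W) (range (incl n))ᶜ m).hom
    ((toExtCollar R R m).hom z) with hμ
  -- the factorisation `a ↦ Φ⁻¹ (cI⁻¹ (cechCap μ (of univ (Θ⁻¹ (base^* a)))))`
  let G : singularCohomology R R W p → Cech R 𝑹 (range (incl n : W → ExtCollar n W)) p := fun a =>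
    Cech.of R 𝑹 (OpenNhd.univ _) (subsetCochains.thetaInv p (singularCohomology.map R R baseCM p a))
  let E : clocalHomology R R (ExtCollar n W) (range (incl n)) q →
      relativeSingularHomology R R W ((𝓡∂ (n + 1)).boundary W) q := fun y =>
    (toExtCollar R R q).inv ((relativeSingularHomology.concreteIso R R (ExtCollar n W) (range (incl n))ᶜ q).inv y)
  have hfac : (fun a : singularCohomology R R W p => relCapProduct (M := R) ((𝓡∂ (n + 1)).boundary W) h a z) =
      E ∘ (cechCap isClosed_range_incl h μ) ∘ G := by
    funext a
    simp only [Function.comp_apply, G, E]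
    rw [relCapProduct_eq_toExtCollar_inv, hμ, cechCap_of_univ_thetaInv, Iso.hom_inv_id_apply]
  rw [hfac]
  refine Function.Bijective.comp ?_ ((hC p q h).comp ?_)
  · -- `E` is bijective (two isomorphisms)
    exact (toExtCollar R R q).toLinearEquiv.symm.bijective.comp
      (relativeSingularHomology.concreteIso R R (ExtCollar n W) (range (incl n))ᶜ q).toLinearEquiv.symm.bijective
  · -- `G` is bijective (`base^*`, `Θ⁻¹`, `of univ`)
    refine ((of_univ_bijective R (SimplexSpan.coefR R) p).comp (subsetCochains.thetaInv_bijective p)).comp ?_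
    exact (asIso (singularCohomology.map R R (baseCM (n := n) (W := W)) p)).toLinearEquiv.bijective

end Duality

end ExtCollar

end Literature.AlgebraicTopology.SingularHomology

end
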